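import Literature.Topology.FourManifolds.PuncturedHomotopySphereContractible
import Literature.Topology.FourManifolds.HomotopySpheresSumDimTwoLeaves
import Literature.Topology.FourManifolds.NiceMorseFunctionsProofs
import HarnessLib

/-!
# Punctured homotopy spheres are contractible: `n ≥ 3` unconditionally, and the single
# remaining Morse-theoretic leaf in dimension `2`

Topic `Literature/Topology/FourManifolds`, second proofs file of `HomotopySpheresInverse.lean` for
its named fact `Literature.Topology.FourManifolds.HomotopySphere.contractibleSpace_compl_singleton`
(for a homotopy `n`-sphere `Σ`, `n ≥ 2`, and any point `p`, `Σ ∖ {p}` is contractible — the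
homotopy theory in Kervaire–Milnor, *Groups of homotopy spheres I* (1963), proof of Lemma 2.4,
p. 507: "`W` contains `M - Interior i(½Dⁿ)` as deformation retract, and therefore is
contractible"), after `PuncturedHomotopySphereContractible.lean`, which left the trust base
{`hurewicz_subsingleton` (or `homotopyAddition`), `nonemptyDiffeomorphSphere_two`}.

Meanwhile the tree PROVED

* the vanishing form of the Hurewicz theorem,
  `Literature.AlgebraicTopology.SingularHomology.hurewicz_subsingleton_holds`
  (`HurewiczVanishingProofs.lean`; Hatcher 2002, Thm. 4.32, by Spanier's chain-level argument and
  the homotopy addition theorem `homotopyAddition_holds`);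
* `Θ₂ = 0` (`nonemptyDiffeomorphSphere_two`: every smooth surface homotopy equivalent to `S²` is
  diffeomorphic to `S²`) FROM Matsumoto's one-minimum–one-maximum theorem in dimension `2` alone
  (`nonemptyDiffeomorphSphere_two_of_niceMorse`, `HomotopySpheresSumDimTwoLeaves.lean`: no
  saddles on simply connected closed surfaces, `criticalSetOfIndex_one_eq_empty_of_simplyConnected`,
  and Reeb's sphere theorem `IsMorse.nonempty_diffeomorph_sphere_two_of_ncard_criticalSet_eq_two`),
  and the reductions of Matsumoto's Thm. 3.35 to the cancellation of one index-`0`/`1` pair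
  (`exists_isMorse_ncard_criticalSetOfIndex_eq_one_of_cancel_pair`), to Milnor's First
  Cancellation Theorem 5.4 on a slab and to Assertion 6 of its proof
  (`NiceMorseFunctionsProofs.lean`, `SPC4HandlesSelfIndexingProofs.lean`).

This file draws the consequences for the punctured homotopy sphere, all **proved** (no
definition, no named fact):

* `HomotopySphere.contractibleSpace_compl_singleton_of_three_le` — **for `n ≥ 3`, `Σ ∖ {p}` is
  contractible, unconditionally** (`contractibleSpace_compl_singleton_of_hurewicz_of_le` fed with
  `hurewicz_subsingleton_holds`): Kervaire–Milnor's assertion in every dimension `n ≥ 3`;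
* `HomotopySphere.contractibleSpace_compl_singleton_two_of_isMorse` — in dimension `2`, for ONE
  homotopy sphere `Σ`: if `Σ` carries a Morse function with exactly one critical point of index
  `0` and exactly one of index `2`, then `Σ ∖ {p}` is contractible for every `p` (no saddles by
  simple connectivity and the orientation of `Σ`, `criticalSetOfIndex_one_eq_empty`; two critical
  points, Reeb: `Σ ≅ S²`; stereographic projection);
* the named fact from each single remaining statement of Morse theory on closed surfaces:
  `…_of_sphere_two` (⇐ `Θ₂ = 0` alone), `…_of_niceMorse` (⇐ Matsumoto's Thm. 3.35 for `m = 2`,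
  `exists_isMorse_ncard_criticalSetOfIndex_eq_one 2`), `…_of_cancel_pair` (⇐ the cancellation of
  one index-`0`/`1` pair on a triad, `Cobordism.Milnor1965_cancel_pair_index_zero`),
  `…_of_exists_isSelfIndexing` (⇐ spc4.S24 (b) for `n = 2`), `…_of_firstCancellation_slab`
  (⇐ Milnor 1965, Thm. 5.4 on a slab) and `…_of_modelChart` (⇐ Assertion 6 of its proof).

So the trust base of `HomotopySphere.contractibleSpace_compl_singleton` is now ONE statement of
Morse theory on closed surfaces (any of the above); the discharge
`contractibleSpace_compl_singleton_holds` is `contractibleSpace_compl_singleton_of_niceMorse`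
(resp. `…_of_cancel_pair`, …) applied to the corresponding `_holds` once it lands.

## References

* M. Kervaire, J. Milnor, *Groups of homotopy spheres I*, Ann. of Math. 77 (1963), proof of
  Lemma 2.4 (p. 507); p. 507 ("`Θ₁ = Θ₂ = 0`"). [KervaireMilnorAnnals1963]
* A. Hatcher, *Algebraic Topology*, CUP (2002), Thm. 4.32. [HatcherAT2002]
* Y. Matsumoto, *An Introduction to Morse Theory*, Transl. Math. Monogr. 208, AMS (2001),
  Thm. 1.16, Thm. 3.35 and its proof. [Matsumoto2001]
* J. Milnor, *Lectures on the h-cobordism theorem*, Princeton (1965), Thm. 5.4, §8 Thm. 8.1.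
  [MilnorHCobordism1965]
-/

noncomputable section

open Set Function Metric Topology
open scoped Manifold ContDiff Topology ContinuousMap

namespace Literature.Topology.FourManifolds

namespace HomotopySphere

open Literature.AlgebraicTopology.Homotopy Literature.AlgebraicTopology.SingularHomology

/-! ### Dimensions `n ≥ 3`: unconditional -/

/-- **Punctured homotopy spheres are contractible, `n ≥ 3` (Kervaire–Milnor 1963, proof of
Lemma 2.4, p. 507), unconditionally.** `Σ ∖ {p}` is simply connected (general position,
`n ≥ 3`) and acyclic (Mayer–Vietoris), hence weakly contractible by the vanishing form of the
Hurewicz theorem — now the tree's theorem `hurewicz_subsingleton_holds` (Hatcher Thm. 4.32) —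
and contractible as a space dominated by a finite cube complex
(`contractibleSpace_compl_singleton_of_hurewicz_of_le`, `PuncturedHomotopySphereContractible.lean`).
[cite: KervaireMilnorAnnals1963, Lemma 2.4, proof (p. 507)] [cite: HatcherAT2002, Thm. 4.32] -/
theorem contractibleSpace_compl_singleton_of_three_le {n : ℕ} (hn : 3 ≤ n) (S : HomotopySphere n)
    (p : S.carrier) : ContractibleSpace {x : S.carrier // x ≠ p} :=
  contractibleSpace_compl_singleton_of_hurewicz_of_le hurewicz_subsingleton_holds hn S p

/-! ### Dimension `2`: one homotopy sphere carrying a Morse function with one minimum and one maximum -/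

/-- **Dimension `2`, for one homotopy sphere**: if a homotopy `2`-sphere `Σ` carries a Morse
function with exactly one critical point of index `0` and exactly one of index `2`, then
`Σ ∖ {p}` is contractible for every `p ∈ Σ`.  `Σ` is simply connected (`Σ ≃ S²`) and oriented,
so the Morse function has no saddle (`criticalSetOfIndex_one_eq_empty`, Matsumoto 2001, proof of
Thm. 3.35: a lowest saddle would disconnect a regular level), hence exactly two critical points
(`IsMorse.ncard_criticalSet_eq_two_of_counts`); by Reeb's theorem `Σ` is then diffeomorphic to
`S²` (`IsMorse.nonempty_diffeomorph_sphere_two_of_ncard_criticalSet_eq_two`, Matsumoto Thm. 1.16,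
Milnor 1963 Thm. 4.1 and Remark), and `S² ∖ {v} ≅ ℝ²` by stereographic projection
(`contractibleSpace_compl_singleton_of_diffeomorph`). Kervaire–Milnor 1963, p. 507.
[cite: KervaireMilnorAnnals1963, Lemma 2.4, proof (p. 507)] [cite: Matsumoto2001, Thm. 1.16 and proof of Thm. 3.35] -/
theorem contractibleSpace_compl_singleton_two_of_isMorse (S : HomotopySphere 2) {f : S.carrier → ℝ}
    (hf : IsMorse (𝓡 2) f) (h0 : (criticalSetOfIndex (𝓡 2) f 0).ncard = 1)
    (h2 : (criticalSetOfIndex (𝓡 2) f 2).ncard = 1) (p : S.carrier) :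
    ContractibleSpace {x : S.carrier // x ≠ p} := by
  obtain ⟨e⟩ := S.nonempty_homotopyEquiv
  haveI := simplyConnectedSpace_euclideanSphere (n := 2) (by norm_num)
  haveI : SimplyConnectedSpace S.carrier := e.simplyConnectedSpace
  obtain ⟨pbot, hbot⟩ := Set.ncard_eq_one.1 h0
  obtain ⟨ptop, htop⟩ := Set.ncard_eq_one.1 h2
  have h1 : criticalSetOfIndex (𝓡 2) f 1 = ∅ :=
    criticalSetOfIndex_one_eq_empty S.orientation hf hbot htop
  obtain ⟨φ⟩ := hf.nonempty_diffeomorph_sphere_two_of_ncard_criticalSet_eq_two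
    (hf.ncard_criticalSet_eq_two_of_counts h0 h1 h2)
  exact S.contractibleSpace_compl_singleton_of_diffeomorph φ p

/-! ### The named fact from one statement of Morse theory on closed surfaces -/

/-- **`HomotopySphere.contractibleSpace_compl_singleton` from `Θ₂ = 0` alone** (the Hurewicz
leaf of `contractibleSpace_compl_singleton_of_hurewicz_of_two` being discharged by
`hurewicz_subsingleton_holds`): `n ≥ 3` unconditionally, `n = 2` from
`nonemptyDiffeomorphSphere_two` (Kervaire–Milnor 1963, p. 507: "`Θ₂ = 0`", classification of
surfaces) and the stereographic projection.
[cite: KervaireMilnorAnnals1963, Lemma 2.4, proof (p. 507)] -/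
theorem contractibleSpace_compl_singleton_of_sphere_two (h2 : nonemptyDiffeomorphSphere_two.{0}) :
    HomotopySphere.contractibleSpace_compl_singleton :=
  contractibleSpace_compl_singleton_of_hurewicz_of_two hurewicz_subsingleton_holds h2

/-- **`HomotopySphere.contractibleSpace_compl_singleton` from Matsumoto's Thm. 3.35 in dimension
`2` alone** (`exists_isMorse_ncard_criticalSetOfIndex_eq_one 2`: every closed connected smooth
surface carries a Morse function with one critical point of index `0` and one of index `2`):
`Θ₂ = 0` follows from it (`nonemptyDiffeomorphSphere_two_of_niceMorse`: no saddles on simply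
connected closed surfaces, Reeb's sphere theorem), then `contractibleSpace_compl_singleton_of_sphere_two`.
[cite: KervaireMilnorAnnals1963, Lemma 2.4, proof (p. 507)] [cite: Matsumoto2001, Thm. 3.35] -/
theorem contractibleSpace_compl_singleton_of_niceMorse
    (hU : exists_isMorse_ncard_criticalSetOfIndex_eq_one.{0} 2) :
    HomotopySphere.contractibleSpace_compl_singleton :=
  contractibleSpace_compl_singleton_of_sphere_two (nonemptyDiffeomorphSphere_two_of_niceMorse hU)

/-- The same from the **cancellation of one index-`0`/`1` pair on a triad**
(`Cobordism.Milnor1965_cancel_pair_index_zero`; Milnor 1965, proof of Thm. 8.1, Index 0, via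
Thms. 4.2 and 5.4), through the tree's assembly of Matsumoto's Thm. 3.35 from it
(`exists_isMorse_ncard_criticalSetOfIndex_eq_one_of_cancel_pair`, `NiceMorseFunctionsProofs.lean`).
[cite: KervaireMilnorAnnals1963, Lemma 2.4, proof (p. 507)] [cite: MilnorHCobordism1965, proof of Thm. 8.1 Index 0 (PDF p. 54)] -/
theorem contractibleSpace_compl_singleton_of_cancel_pair
    (hC : Cobordism.Milnor1965_cancel_pair_index_zero.{0}) :
    HomotopySphere.contractibleSpace_compl_singleton :=
  contractibleSpace_compl_singleton_of_niceMorse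
    (exists_isMorse_ncard_criticalSetOfIndex_eq_one_of_cancel_pair hC 2)

/-- The same from **spc4.S24 (b) in dimension `2`** (`exists_isMorse_isSelfIndexing 2`: a
self-indexing Morse function with one critical point of index `0` and one of index `2`; Milnor
1965, Thms. 4.8 and 8.1), which contains Matsumoto's Thm. 3.35
(`nonemptyDiffeomorphSphere_two_of_exists_isSelfIndexing`).
[cite: KervaireMilnorAnnals1963, Lemma 2.4, proof (p. 507)] [cite: MilnorHCobordism1965, Thm. 4.8 and §8] -/
theorem contractibleSpace_compl_singleton_of_exists_isSelfIndexing
    (hS : FourManifolds.exists_isMorse_isSelfIndexing.{0} 2) :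
    HomotopySphere.contractibleSpace_compl_singleton :=
  contractibleSpace_compl_singleton_of_sphere_two (nonemptyDiffeomorphSphere_two_of_exists_isSelfIndexing hS)

/-- The same from **Milnor's First Cancellation Theorem 5.4 on a slab**
(`Cobordism.Milnor1965_firstCancellation_slab`), through
`nonemptyDiffeomorphSphere_two_of_firstCancellation_slab`.
[cite: KervaireMilnorAnnals1963, Lemma 2.4, proof (p. 507)] [cite: MilnorHCobordism1965, Thm. 5.4 (PDF p. 27)] -/
theorem contractibleSpace_compl_singleton_of_firstCancellation_slab
    (h54 : Cobordism.Milnor1965_firstCancellation_slab.{0}) :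
    HomotopySphere.contractibleSpace_compl_singleton :=
  contractibleSpace_compl_singleton_of_sphere_two (nonemptyDiffeomorphSphere_two_of_firstCancellation_slab h54)

/-- The same from **Assertion 6 in Milnor's proof of Thm. 5.4**
(`Cobordism.Milnor1965_cancellation_modelChart`), through `nonemptyDiffeomorphSphere_two_of_modelChart`.
[cite: KervaireMilnorAnnals1963, Lemma 2.4, proof (p. 507)] [cite: MilnorHCobordism1965, proof of Thm. 5.4, Assertion 6 (PDF pp. 30–31)] -/
theorem contractibleSpace_compl_singleton_of_modelChart
    (hE : Cobordism.Milnor1965_cancellation_modelChart.{0}) :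
    HomotopySphere.contractibleSpace_compl_singleton :=
  contractibleSpace_compl_singleton_of_sphere_two (nonemptyDiffeomorphSphere_two_of_modelChart hE)

end HomotopySphere

end Literature.Topology.FourManifolds

end
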